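import Summits.QuantumFields.YangMills.Theorems.UnitScaleTiltProp8FibreLiftCurve
import HarnessLib

/-!
# Route `UnitScaleTilt`, crux K1 «MinimiserStabilityRegPr» (stmt-QuantumFields-19200), stub `stub_prop8` (V2) — sub-lemma V2-EL, part 7c:
# **THE k-FOLD TANGENT CURVES OF THE (0.4)-DESCENT FIBRE** (`exists_iter_lift_curve`)

Cell `ym3-torus` ∕ fleet seat `ym-ust-19200-p2` g4.  The k-fold descent `U ↦ Ū^{(k)} = avg_{k−1} ∘ ⋯ ∘ avg_0 (U)` (`Setup.Averaging.iter` of Bałaban's (0.4)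
block averaging with the printed exp-mean-log average on `SU(2)`) has, through every field `U₀` whose iterated averages are all `t₀`-small
(`stokesConst·t₀ ≤ |I|⁻¹/1000`), a fibre `{U : Ū^{(k)} = Ū₀^{(k)}}` rich in DIFFERENTIABLE CURVES: every bondwise-differentiable ambient family `Γ₀(t)`
through `U₀` is corrected into a family `γ(t)` with `γ(0) = U₀`, every bond differentiable at `0`, `γ̄^{(k)}(t) = λ(t)` for any prescribed
bondwise-differentiable level-`k` target `λ` with `λ(0) = Ū₀^{(k)}`, and `γ(t) = Γ₀(t)` at every bond outside the bottom set `T₀` of ANY tower of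
exceptional sets `T_i ⊆ {level-i bonds}` that is closed downwards under the central-bond maps (`c ∈ T_{i+1} ⇒ β(c) ∈ T_i`) and off whose top set the
target already agrees with `Γ̄₀^{(k)}(t)`.  The minimal tower (iterated central bonds `β^{k−i}(T_k)`) gives tangent vectors supported on `{b₀} ∪ β^k({level-k
bonds})` — a spanning family of the tangent space of the k-fold fibre (dimension count: `#bonds₀ − #bonds_k`), where part 5b ∕ 6 (g3) reached only the
tangent space of the TOP-STEP slice.  PROOF: induction on `k` peeling the top averaging (`iter (k+1) = avg_k ∘ iter k`): lift the target one level by part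
7b at level `k` (ambient family `Γ̄₀^{(k)}(t)`, differentiable by `differentiableAt_coe_iter`), then lift the result by the induction hypothesis; the
downward closure of the tower is exactly what the selective clause of part 7b needs.  Sorry-free, no definition. [folklore]
References: T. Bałaban, CMP 102 (1985) 277–309 [Balaban1985Variational] ((127) p.297, (133) p.298, Sect. F p.300); CMP 109 (1987) 249–301
[Balaban1987RG1] ((0.4), (0.11) p.253).
-/

noncomputable section

open scoped BigOperators Matrix.Norms.L2Operator Matrix
open Filter Topology Asymptotics NormedSpace Function

namespace Summit.QuantumFields.YangMills.Theorems.Prop8Criticality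

open Literature.MathematicalPhysics.QuantumFieldTheory.Balaban1983to89
open T4Continuum AveragingRT BlockAveraging BlockAveragingHaarAC BlockAveragingEMLHaarAC ExpMeanLog
open Summit.QuantumFields.YangMills.Theorems.BlockAvgCorrector (stokesConst stokesConst_nonneg emlWeight_pos emlWeight_le_one)

variable {P : Params}

section Iter

/-- One more averaging on top: `Ū^{(n+1)} = avg_n(Ū^{(n)})` (definitional unfolding of `Setup.Averaging.iter`). [cite: Balaban1987RG1, (0.11) p.253] -/
theorem iter_succ_apply (ℰ : LoopAverage (Matrix.specialUnitaryGroup (Fin 2) ℂ)) (n : ℕ)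
    (U : GaugeField P 0 (Matrix.specialUnitaryGroup (Fin 2) ℂ)) :
    Averaging.iter (fun i => blockAvg (P := P) (j := i) ℰ) (n + 1) U =
      (blockAvg (P := P) (j := n) ℰ).avg (Averaging.iter (fun i => blockAvg (P := P) (j := i) ℰ) n U) := by
  show ((blockAvg (P := P) (j := n) ℰ).avg ∘ Averaging.iter (fun i => blockAvg (P := P) (j := i) ℰ) n) U = _
  rfl

/-- One more averaging on top, for the (0.4) family: `Ū^{(n+1)} = avgFun ℰ (Ū^{(n)})`. [cite: Balaban1987RG1, (0.11) p.253] -/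
theorem iter_succ_eq_avgFun (ℰ : LoopAverage (Matrix.specialUnitaryGroup (Fin 2) ℂ)) (n : ℕ)
    (U : GaugeField P 0 (Matrix.specialUnitaryGroup (Fin 2) ℂ)) :
    Averaging.iter (fun i => blockAvg (P := P) (j := i) ℰ) (n + 1) U = avgFun ℰ (Averaging.iter (fun i => blockAvg (P := P) (j := i) ℰ) n U) := by
  rw [iter_succ_apply]
  rfl

/-- No averaging: `Ū^{(0)} = U` (definitional unfolding of `Setup.Averaging.iter`). [cite: Balaban1987RG1, (0.11) p.253] -/
theorem iter_zero_apply (ℰ : LoopAverage (Matrix.specialUnitaryGroup (Fin 2) ℂ)) (U : GaugeField P 0 (Matrix.specialUnitaryGroup (Fin 2) ℂ)) :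
    Averaging.iter (fun i => blockAvg (P := P) (j := i) ℰ) 0 U = U := by
  show id U = U
  rfl

/-- **THE ITERATED (0.4)-AVERAGE ALONG A BONDWISE DIFFERENTIABLE FAMILY IS BONDWISE DIFFERENTIABLE** at `t = 0`, provided the iterated averages of the base
field up to the previous level are `t₀`-small with `stokesConst·(2t₀) < 1/3` (induction on the level with part 5a's `differentiableAt_coe_avgFun`; the
loop variables stay in the guard near `t = 0` by continuity, part 7b's `eventually_small_of_tendsto`). [cite: Balaban1987RG1, (0.4) p.253] -/
theorem differentiableAt_coe_iter {t₀ : ℝ} (ht₀ : 0 < t₀) (h2t₀ : stokesConst P * (2 * t₀) < 1 / 3)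
    (Γ₀ : ℝ → GaugeField P 0 (Matrix.specialUnitaryGroup (Fin 2) ℂ))
    (hΓ₀diff : ∀ b : PBond P 0, DifferentiableAt ℝ (fun t : ℝ => (Γ₀ t b : Matrix (Fin 2) (Fin 2) ℂ)) 0) :
    ∀ n : ℕ, (∀ i, i < n → PlaqSmall t₀ (Averaging.iter (fun i => blockAvg (P := P) (j := i) (expMeanLogSU (n := Fin 2))) i (Γ₀ 0))) →
      ∀ b : PBond P n, DifferentiableAt ℝ
        (fun t : ℝ => ((Averaging.iter (fun i => blockAvg (P := P) (j := i) (expMeanLogSU (n := Fin 2))) n (Γ₀ t) b :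
          Matrix.specialUnitaryGroup (Fin 2) ℂ) : Matrix (Fin 2) (Fin 2) ℂ)) 0 := by
  intro n
  induction n with
  | zero =>
    intro _ b
    simp only [iter_zero_apply]
    exact hΓ₀diff b
  | succ n ih =>
    intro hsm c
    have ih' := ih (fun i hi => hsm i (Nat.lt_succ_of_lt hi))
    have hcont : ∀ b : PBond P n, Tendsto
        (fun t : ℝ => ((Averaging.iter (fun i => blockAvg (P := P) (j := i) (expMeanLogSU (n := Fin 2))) n (Γ₀ t) b :
          Matrix.specialUnitaryGroup (Fin 2) ℂ) : Matrix (Fin 2) (Fin 2) ℂ)) (𝓝 0)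
        (𝓝 ((Averaging.iter (fun i => blockAvg (P := P) (j := i) (expMeanLogSU (n := Fin 2))) n (Γ₀ 0) b :
          Matrix.specialUnitaryGroup (Fin 2) ℂ) : Matrix (Fin 2) (Fin 2) ℂ)) := fun b => (ih' b).continuousAt.tendsto
    obtain ⟨hev, hloop⟩ := eventually_small_of_tendsto
      (Γ := fun t => Averaging.iter (fun i => blockAvg (P := P) (j := i) (expMeanLogSU (n := Fin 2))) n (Γ₀ t))
      ht₀ h2t₀ (hsm n (Nat.lt_succ_self n)) hcont
    simp only [iter_succ_eq_avgFun]
    exact differentiableAt_coe_avgFun ih' c (hev.mono fun t ht => ht.2 c) (hloop c)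

/-- **THE k-FOLD TANGENT CURVES OF THE (0.4)-DESCENT FIBRE.**  Fix `t₀ > 0` with `stokesConst·t₀ ≤ |I|⁻¹/1000`.  For every level `n ≤ m + K`, every
bondwise-differentiable family `Γ₀(t)` of finest-lattice `SU(2)` fields whose base field has `t₀`-small iterated averages `Γ̄₀(0)^{(i)}`, `i < n`, every
tower `T_i ⊆ {level-i bonds}` closed downwards under the central-bond maps below level `n`, and every bondwise-differentiable level-`n` target `λ(t)`
with `λ(0) = Γ̄₀(0)^{(n)}` that agrees with `Γ̄₀(t)^{(n)}` near `t = 0` off `T_n`: there is a family `γ(t)` with `γ(0) = Γ₀(0)`, every bond differentiable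
at `0`, `γ̄(t)^{(n)} = λ(t)` near `0`, and `γ(t)(b) = Γ₀(t)(b)` near `0` for every bond `b ∉ T₀`.
[cite: Balaban1985Variational, (127) p.297, Sect. F p.300; Balaban1987RG1, (0.11) p.253] -/
theorem exists_iter_lift_curve {t₀ : ℝ} (ht₀ : 0 < t₀) (hsmall : stokesConst P * t₀ ≤ emlWeight P / 1000) :
    ∀ n : ℕ, n ≤ P.m + P.K →
    ∀ Γ₀ : ℝ → GaugeField P 0 (Matrix.specialUnitaryGroup (Fin 2) ℂ),
      (∀ b : PBond P 0, DifferentiableAt ℝ (fun t : ℝ => (Γ₀ t b : Matrix (Fin 2) (Fin 2) ℂ)) 0) →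
      (∀ i, i < n → PlaqSmall t₀ (Averaging.iter (fun i => blockAvg (P := P) (j := i) (expMeanLogSU (n := Fin 2))) i (Γ₀ 0))) →
    ∀ T : (i : ℕ) → Set (PBond P i),
      (∀ i, i < n → ∀ c : PBond P (i + 1), c ∈ T (i + 1) → centralBond c ∈ T i) →
    ∀ lam : ℝ → GaugeField P n (Matrix.specialUnitaryGroup (Fin 2) ℂ),
      (∀ c : PBond P n, DifferentiableAt ℝ (fun t : ℝ => ((lam t c : Matrix.specialUnitaryGroup (Fin 2) ℂ) : Matrix (Fin 2) (Fin 2) ℂ)) 0) →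
      lam 0 = Averaging.iter (fun i => blockAvg (P := P) (j := i) (expMeanLogSU (n := Fin 2))) n (Γ₀ 0) →
      (∀ c : PBond P n, c ∉ T n → ∀ᶠ t in 𝓝 (0 : ℝ),
        lam t c = Averaging.iter (fun i => blockAvg (P := P) (j := i) (expMeanLogSU (n := Fin 2))) n (Γ₀ t) c) →
    ∃ γ : ℝ → GaugeField P 0 (Matrix.specialUnitaryGroup (Fin 2) ℂ),
      γ 0 = Γ₀ 0 ∧
      (∀ b : PBond P 0, DifferentiableAt ℝ (fun t : ℝ => (γ t b : Matrix (Fin 2) (Fin 2) ℂ)) 0) ∧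
      (∀ᶠ t in 𝓝 (0 : ℝ), Averaging.iter (fun i => blockAvg (P := P) (j := i) (expMeanLogSU (n := Fin 2))) n (γ t) = lam t) ∧
      ∀ b : PBond P 0, b ∉ T 0 → ∀ᶠ t in 𝓝 (0 : ℝ), γ t b = Γ₀ t b := by
  intro n
  induction n with
  | zero =>
    intro _ Γ₀ hΓ₀diff _ T _ lam hlamdiff hlam0 hlamT
    refine ⟨lam, ?_, hlamdiff, Filter.Eventually.of_forall fun t => iter_zero_apply _ _, fun b hb => ?_⟩
    · rw [hlam0, iter_zero_apply]
    · filter_upwards [hlamT b hb] with t ht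
      rw [ht, iter_zero_apply]
  | succ n ih =>
    intro hn Γ₀ hΓ₀diff hsm T hT lam hlamdiff hlam0 hlamT
    classical
    have h2t₀ : stokesConst P * (2 * t₀) < 1 / 3 := by
      have := emlWeight_le_one P
      have : stokesConst P * (2 * t₀) = 2 * (stokesConst P * t₀) := by ring
      linarith
    -- the ambient family one level below the top: `Λ(t) = Γ̄₀(t)^{(n)}`
    set Λ : ℝ → GaugeField P n (Matrix.specialUnitaryGroup (Fin 2) ℂ) :=
      fun t => Averaging.iter (fun i => blockAvg (P := P) (j := i) (expMeanLogSU (n := Fin 2))) n (Γ₀ t) with hΛ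
    have hΛdiff : ∀ b : PBond P n, DifferentiableAt ℝ (fun t : ℝ => ((Λ t b : Matrix.specialUnitaryGroup (Fin 2) ℂ) : Matrix (Fin 2) (Fin 2) ℂ)) 0 :=
      differentiableAt_coe_iter ht₀ h2t₀ Γ₀ hΓ₀diff n (fun i hi => hsm i (Nat.lt_succ_of_lt hi))
    have hΛ0 : PlaqSmall t₀ (Λ 0) := hsm n (Nat.lt_succ_self n)
    have hlam0' : lam 0 = avgFun (expMeanLogSU (n := Fin 2)) (Λ 0) := by rw [hlam0, iter_succ_eq_avgFun]
    -- lift the target one level (part 7b at level `n`)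
    obtain ⟨μ, hμ0, hμdiff, hμev⟩ := exists_fibre_lift_curve (P := P) (j := n) hn ht₀ hsmall Λ hΛdiff hΛ0 lam hlamdiff hlam0'
    -- the new target agrees with `Λ` off `T n`
    have hμT : ∀ c : PBond P n, c ∉ T n → ∀ᶠ t in 𝓝 (0 : ℝ), μ t c = Λ t c := by
      intro c hc
      by_cases hcen : ∃ c' : PBond P (n + 1), centralBond c' = c
      · obtain ⟨c', rfl⟩ := hcen
        have hc' : c' ∉ T (n + 1) := fun h => hc (hT n (Nat.lt_succ_self n) c' h)
        filter_upwards [hμev, hlamT c' hc'] with t ht hlt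
        refine ht.2.2 c' ?_
        rw [hlt, iter_succ_eq_avgFun]
      · push Not at hcen
        filter_upwards [hμev] with t ht
        exact ht.2.1 c fun c' h => hcen c' h
    -- lift the new target all the way down (induction hypothesis)
    obtain ⟨γ, hγ0, hγdiff, hγev, hγT⟩ := ih (Nat.le_of_succ_le hn) Γ₀ hΓ₀diff
      (fun i hi => hsm i (Nat.lt_succ_of_lt hi)) T (fun i hi => hT i (Nat.lt_succ_of_lt hi)) μ hμdiff hμ0 hμT
    refine ⟨γ, hγ0, hγdiff, ?_, hγT⟩
    filter_upwards [hγev, hμev] with t hγt hμt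
    rw [iter_succ_eq_avgFun, hγt, hμt.1]

end Iter

end Summit.QuantumFields.YangMills.Theorems.Prop8Criticality

end
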